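import Summits.Ventures.QEC.Census.FoldDefs
import HarnessLib

/-!
# Fold enumeration — definitions, part 2: fold/section words, the index facts `Geo.OK`, kernels, translations,
matching predicates, node / lift / zero checks, slicing, the base check and the step-frugal twins

Continuation of `Census/FoldDefs.lean` (same conventions); soundness in `Census/FoldLin.lean` … `Census/FoldLift2.lean`.
-/

namespace Summit.Ventures.QEC.Census.Fold

/-! ## Proof-side linear maps of a fold step (statements; the checker never evaluates them) -/

namespace Geo

variable (G : Geo)

/-- The fold of a big word: `⊕_{J ∈ u} e_{foldIdx J}`. -/
def foldW (u : ℕ) : ℕ := lin (fun J => 2 ^ G.foldIdx J) G.n 0 u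

/-- A big index is a section point (`emb (foldIdx J) = J`). -/
def isEmb (J : ℕ) : Bool := G.emb (G.foldIdx J) == J

/-- Section part of a big word, in small coordinates: `a(u) = ⊕_{J ∈ u, J section} e_{foldIdx J}`. -/
def aPart (u : ℕ) : ℕ := lin (fun J => if G.isEmb J then 2 ^ G.foldIdx J else 0) G.n 0 u

/-- Partner part of a big word, in small coordinates. -/
def bPart (u : ℕ) : ℕ := lin (fun J => if G.isEmb J then 0 else 2 ^ G.foldIdx J) G.n 0 u

/-- Place a small word on the section points. -/
def embW (y : ℕ) : ℕ := lin (fun j => 2 ^ G.emb j) G.ns 0 y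

/-- Place a small word on the partner points. -/
def parW (y : ℕ) : ℕ := lin (fun j => 2 ^ G.partner (G.emb j)) G.ns 0 y

/-- The doubled word `embW c ⊕ parW c` (fold `0`). -/
def double (c : ℕ) : ℕ := G.embW c ^^^ G.parW c

/-- The finitely many index facts of a fold step that the soundness proofs use (decided per level). -/
structure OK : Prop where
  /-- section points are big indices -/
  emb_lt : ∀ j, j < G.ns → G.emb j < G.n
  /-- partners are big indices -/
  partner_lt : ∀ J, J < G.n → G.partner J < G.n
  /-- folds are small indices -/
  foldIdx_lt : ∀ J, J < G.n → G.foldIdx J < G.ns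
  /-- the section is a section -/
  fold_emb : ∀ j, j < G.ns → G.foldIdx (G.emb j) = j
  /-- partners lie in the same fibre -/
  fold_partner : ∀ J, J < G.n → G.foldIdx (G.partner J) = G.foldIdx J
  /-- a partner of a section point is not a section point -/
  partner_emb_ne : ∀ j, j < G.ns → G.partner (G.emb j) ≠ G.emb j
  /-- `partner` is an involution -/
  partner_partner : ∀ J, J < G.n → G.partner (G.partner J) = J
  /-- every big index is the section point of its fibre or that point's partner -/
  cover : ∀ J, J < G.n → G.emb (G.foldIdx J) = J ∨ G.partner (G.emb (G.foldIdx J)) = J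

/-- `OK` as a decidable conjunction (per level: `theorem ok : G.OK := (Geo.OK_iff G).2 (by decide)`). -/
theorem OK_iff :
    G.OK ↔ ((∀ j, j < G.ns → G.emb j < G.n) ∧ (∀ J, J < G.n → G.partner J < G.n) ∧
      (∀ J, J < G.n → G.foldIdx J < G.ns) ∧ (∀ j, j < G.ns → G.foldIdx (G.emb j) = j) ∧
      (∀ J, J < G.n → G.foldIdx (G.partner J) = G.foldIdx J) ∧
      (∀ j, j < G.ns → G.partner (G.emb j) ≠ G.emb j) ∧ (∀ J, J < G.n → G.partner (G.partner J) = J) ∧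
      (∀ J, J < G.n → G.emb (G.foldIdx J) = J ∨ G.partner (G.emb (G.foldIdx J)) = J)) :=
  ⟨fun ⟨h1, h2, h3, h4, h5, h6, h7, h8⟩ => ⟨h1, h2, h3, h4, h5, h6, h7, h8⟩,
   fun ⟨h1, h2, h3, h4, h5, h6, h7, h8⟩ => ⟨h1, h2, h3, h4, h5, h6, h7, h8⟩⟩

end Geo

/-- Kernel membership of a word of the two-block code, read on `n` bits: the column syndrome vanishes. -/
def TCode.ker (C : TCode) (n : ℕ) (u : ℕ) : Prop := lin C.col n 0 u = 0

end Summit.Ventures.QEC.Census.Fold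

namespace Summit.Ventures.QEC.Census.Fold

/-! ## Translations of words, matching predicate, drivers -/

/-- Translation of a word on the two-block torus `ℤ_l × ℤ_m` by `(da, db)`. -/
def transW (l m da db u : ℕ) : ℕ := lin (fun J => 2 ^ transIdx l m da db J) (2 * (l * m)) 0 u

/-- `u` translates onto one of the listed representatives. -/
def Matched (l m : ℕ) (reps : List ℕ) (u : ℕ) : Prop := ∃ r ∈ reps, ∃ da db, transW l m da db u = r

/-- Guard by the parent support: with parent support `p₀ :: _`, skip outputs missing the section point
`emb p₀` (one of each pair `{u, g·u}` is processed); no guard over the zero word. -/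
def guardP (G : Geo) (P : List ℕ) (k : List ℕ → Bool) (S : List ℕ) : Bool :=
  match P with
  | [] => k S
  | p₀ :: _ => !(Nat.testBit (maskOf S) (G.emb p₀)) || k S

/-- NODE CHECK of the enumeration tree: the fibre over the small word with support list `S` is either
certified EMPTY (`⊕_{j∈S} Mr j ≠ 0`, `Mr` = the tabulated reduction of the partner columns modulo ALL
fibre columns) or enumerated, and every output passes the guarded continuation `k`. -/
def nodeCheck (G : Geo) (M Mp Mr : ℕ → ℕ) (W : ℕ) (k : List ℕ → Bool) (S : List ℕ) : Bool :=
  !(xorIdx Mr S == 0) ||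
    (let P := bitsOf G.ns 0 (maskOf S)
     match fiber G M Mp W P with
     | none => false
     | some out => out.all (guardP G P k))

/-- The full-column pivot structure of a fold step (computed once per file, verified by `pivOK`). -/
def fullPiv (G : Geo) (M : ℕ → ℕ) : Piv := gaussPiv ((List.range G.ns).map M)

/-- A column TABLE: the values `f 0, …, f (cnt−1)` packed at `width` bits each. -/
def mkTab (f : ℕ → ℕ) (width cnt : ℕ) : ℕ := xorIdx (fun j => f j * 2 ^ (width * j)) (List.range cnt)

/-- Table lookup. -/
def tab (T width j : ℕ) : ℕ := (T >>> (width * j)) % 2 ^ width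

/-- BASE CHECK on the words `lo ≤ u < hi`: every kernel word (column syndrome `0` on `n` bits) of weight
`≤ W` matches a representative. -/
noncomputable def baseCheck (C : TCode) (n W md : ℕ) (store : KRupFast.Store) (zeroOK : Bool) (lo cnt : ℕ) : Bool :=
  Nat.rec (motive := fun _ => Bool) true
    (fun i acc => acc &&
      (let u := lo + i
       !(lin C.col n 0 u == 0) || !(popc n u ≤ W) ||
         (matchRep C.l C.m md store zeroOK (bitsOf n 0 u)).isSome))
    cnt

end Summit.Ventures.QEC.Census.Fold

namespace Summit.Ventures.QEC.Census.Fold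

/-! ## Per-level structural facts (decided per level) -/

/-- Row fold as a word map on the checks (`foldRow` on each set bit). -/
def Geo.foldRowW (G : Geo) (y : ℕ) : ℕ := lin (fun R => 2 ^ G.foldRow R) G.r 0 y

/-- COLUMN-FOLD IDENTITY of a fold step between two torus codes: folding the check pattern of a big
column gives the small column of the folded qubit (the ring-homomorphism property of the fold;
decided per level). -/
def Geo.ColFold (G : Geo) (Cb Cs : TCode) : Prop :=
  ∀ J, J < G.n → G.foldRowW (Cb.col J) = Cs.col (G.foldIdx J)

/-- The fibre generator of a fold step as a translation amount: `(l/2, 0)` or `(0, m/2)`. -/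
def Geo.gen (G : Geo) : ℕ × ℕ := if G.ax then (G.l / 2, 0) else (0, G.m / 2)

end Summit.Ventures.QEC.Census.Fold

namespace Summit.Ventures.QEC.Census.Fold

/-! ## The LIFT check (fibres over a light small word through a known lift) -/

/-- LIFT CHECK: for a known big kernel word `st` (the lift of the small word under consideration) and a
list `Cands` of small words complete (up to translation) for kernel words of weight `≤ B`, every
candidate `st ⊕ double (translate c)` of weight `≤ W` passes `k`.  (Every big kernel word `u` of weight
`≤ W` in the fibre is of this form with `2·|c| ≤ W + |st|` — `FoldLift`.) -/
def liftCheck (G : Geo) (W st : ℕ) (Cands : List ℕ) (k : List ℕ → Bool) : Bool :=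
  Cands.all fun c => (List.range G.ls).all fun da => (List.range G.ms).all fun db =>
    let u := st ^^^ G.double (transW G.ls G.ms da db c)
    !(popc G.n u ≤ W) || k (bitsOf G.n 0 u)

end Summit.Ventures.QEC.Census.Fold

namespace Summit.Ventures.QEC.Census.Fold

/-! ## The fibre predicate -/

/-- Every big kernel word of weight `≤ W` whose fold is `v` satisfies `Q`. -/
def GoodFib (G : Geo) (C : TCode) (W : ℕ) (Q : ℕ → Prop) (v : ℕ) : Prop :=
  ∀ u, u < 2 ^ G.n → C.ker G.n u → popc G.n u ≤ W → G.foldW u = v → Q u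

end Summit.Ventures.QEC.Census.Fold

namespace Summit.Ventures.QEC.Census.Fold

/-- ZERO-NODE CHECK: the fibre over the zero word consists of the doubles `double c` of the small kernel
words with `2|c| ≤ W`; by translation symmetry it suffices to check the doubles of class REPRESENTATIVES
`Cands` (complete for small kernel words of weight `≤ W/2`). -/
def zeroCheck (G : Geo) (W : ℕ) (Cands : List ℕ) (k : List ℕ → Bool) : Bool :=
  Cands.all fun c => !(popc G.n (G.double c) ≤ W) || k (bitsOf G.n 0 (G.double c))

end Summit.Ventures.QEC.Census.Fold

namespace Summit.Ventures.QEC.Census.Fold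

/-- `List.all` over the positions `≡ res (mod q)` only (work slicing across files). -/
def allMod (q res : ℕ) (k : List ℕ → Bool) : List (List ℕ) → ℕ → Bool
  | [], _ => true
  | S :: L, i => (!(i % q == res) || k S) && allMod q res k L (i + 1)

/-- SLICED NODE CHECK: as `nodeCheck`, but only the outputs at positions `≡ res (mod q)` are continued
(the slices `res = 0 … q−1` together make the node check). -/
def nodeCheckMod (G : Geo) (M Mp Mr : ℕ → ℕ) (W : ℕ) (k : List ℕ → Bool) (S : List ℕ) (q res : ℕ) : Bool :=
  !(xorIdx Mr S == 0) ||
    (let P := bitsOf G.ns 0 (maskOf S)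
     match fiber G M Mp W P with
     | none => false
     | some out => allMod q res (guardP G P k) out 0)

/-- Column-table syndrome of a word on `n` bits (base check). -/
def synTab (T w n u : ℕ) : ℕ := lin (tab T w) n 0 u

/-- BASE CHECK with a column table. -/
noncomputable def baseCheckT (C : TCode) (T w n W md : ℕ) (store : KRupFast.Store) (zeroOK : Bool) (lo cnt : ℕ) : Bool :=
  Nat.rec (motive := fun _ => Bool) true
    (fun i acc => acc &&
      (let u := lo + i
       !(synTab T w n u == 0) || !(popc n u ≤ W) ||
         (matchRep C.l C.m md store zeroOK (bitsOf n 0 u)).isSome))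
    cnt

end Summit.Ventures.QEC.Census.Fold

namespace Summit.Ventures.QEC.Census.Fold

/-! ## Base check with split tables (the 18-qubit bottom code) -/

/-- Minimum over all `l·m` translations of a word, each translation read from two 9-bit-half tables
(`TT` holds, for translation index `t = da·m+db` and half `h ∈ {0,1}`, the table of `x ↦ transW da db (x·2^{9h})`
restricted... ) — generic form: `trs` = list of (tableLow, tableHigh) numeral pairs, entry width `w`,
half width `k`. Returns the minimal translate. -/
def minTrans (trs : List (ℕ × ℕ)) (w k u : ℕ) : ℕ :=
  List.rec (motive := fun _ => ℕ) u
    (fun tp _ acc => let v := tab tp.1 w (u % 2 ^ k) ^^^ tab tp.2 w (u / 2 ^ k); cond (Nat.ble acc v) acc v) trs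

/-- BASE CHECK (split-table form) on the words `lo ≤ u < lo+cnt` of the `2k`-bit bottom code: syndrome by
two half-tables `SL, SR` (entry width `w`), weight by two popcount half-tables `PL, PR` (width 8), and for
kernel words of weight `≤ W`: the minimal translate (tables `trs`) must be a stored representative. -/
noncomputable def baseCheck2 (SL SR PL PR w k W md : ℕ) (trs : List (ℕ × ℕ)) (store : KRupFast.Store)
    (lo cnt : ℕ) : Bool :=
  Nat.rec (motive := fun _ => Bool) true
    (fun i acc => acc &&
      (let u := lo + i
       let ul := u % 2 ^ k
       let uh := u / 2 ^ k
       !(tab SL w ul ^^^ tab SR w uh == 0) || !(tab PL 8 ul + tab PR 8 uh ≤ W) ||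
         (let c := minTrans trs w k u
          (c == 0) || store.get (hkey md c) == c)))
    cnt

end Summit.Ventures.QEC.Census.Fold


namespace Summit.Ventures.QEC.Census.Fold

open Summit.Ventures.QEC.Census

/-! ## Step-frugal twins (the kernel pays per recursion step, not per bit operation) -/

/-- 8-bit popcount table (entry `x` at bits `4x … 4x+3`). -/
def PT8 : ℕ := 0x8776766576656554766565546554544376656554655454436554544354434332766565546554544365545443544343326554544354434332544343324332322176656554655454436554544354434332655454435443433254434332433232216554544354434332544343324332322154434332433232214332322132212110

/-- popcount of the low `8k` bits, one table lookup per byte. -/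
def popc8 : ℕ → ℕ → ℕ
  | 0, _ => 0
  | k + 1, u => tab PT8 4 (u % 256) + popc8 k (u / 256)

/-- `popc n u` computed bytewise (`popcF_eq`). -/
def popcF (n u : ℕ) : ℕ := popc8 (n / 8) (u % 2 ^ (8 * (n / 8))) + popc (n % 8) (u / 2 ^ (8 * (n / 8)))

/-- `double` of a support list: the section and partner placements (`Geo.doubleL_eq`). -/
def Geo.doubleL (G : Geo) (S : List ℕ) : ℕ := maskOf (S.map G.emb) ^^^ maskOf (S.map fun j => G.partner (G.emb j))

/-- ZERO-NODE CHECK, step-frugal form (`zeroCheckS_eq`). -/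
def zeroCheckS (G : Geo) (W : ℕ) (Cands : List ℕ) (k : List ℕ → Bool) : Bool :=
  Cands.all fun c => let u := G.doubleL (bitsOf G.ns 0 c); !(popcF G.n u ≤ W) || k (bitsOf G.n 0 u)

/-- LIFT CHECK, translated-lift form: instead of translating every candidate `c` (all `ls·ms` translations),
translate the LIFT: `STS` holds the translates `τ st` (`τ ∈ ℤ_ls × ℤ_ms` acting on the big torus); a fibre word
`u` with `u ⊕ st = double (τ⁻¹ c₀)` has `τ u = τ st ⊕ double c₀` (`Geo.goodFib_of_liftCheckS`). -/
def liftCheckS (G : Geo) (W : ℕ) (STS Cands : List ℕ) (k : List ℕ → Bool) : Bool :=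
  Cands.all fun c =>
    let D := G.doubleL (bitsOf G.ns 0 c)
    STS.all fun st' => let u := st' ^^^ D; !(popcF G.n u ≤ W) || k (bitsOf G.n 0 u)

end Summit.Ventures.QEC.Census.Fold
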